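import Mathlib
import Summits.Ventures.HodgeRepro.Tier4.Target
import Summits.Ventures.HodgeRepro.Tier4.Common.TargetBall
import Summits.Ventures.HodgeRepro.Tier4.Common.TargetCalculus
import Summits.Ventures.HodgeRepro.Tier4.Common.TargetJacobian
import Summits.Ventures.HodgeRepro.Tier4.Line3.BallChangeOfVariables
import Summits.Ventures.HodgeRepro.Tier4.Line3.DomainTransfer

/-!
# Tier4/Negative/NormaliserDomain — transport of a fundamental domain by a normaliser; the ball-map chain rule (R-I(c), N1/N2)

Blind re-derivation cell `pub-hodge-repro`, Tier 4 «PROVE THE STEP» (README §9–§10), seat t4-L1-p3 (prover), for lead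
g385's R-I(c) (S12912) and the consumer t4-L4-p2 (`Tier4/Negative/TwistObstruction.lean`, T1
`integral_eq_zero_of_normaliser_eigen`). Signatures announced on STATUS.md (S12939).

CONTENT (namespace `Summit.Ventures.HodgeRepro.Tier4.Negative`).
* `volume_image_actM_eq_zero`: `actM M` (`M ∈ U(2,1)`) maps a null measurable subset of the ball to a null set
  (Mathlib's `addHaar_image_le_lintegral_abs_det_fderiv`, the same derivative hypotheses as L3-p1's `integral_image_actM`).
* `jacDet_comp_actM` (**N2 for the ball map**): `jacDet (u ∘ actM M) (v ∘ actM M) z = jacDet u v (actM M z) * (det M / w₂³)`,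
  `w = M (z,1)`, `z ∈ 𝔹` — a corollary of typer-2's chain rule `jacDet_comp` (`Common/TargetCalculus`) and automorphy
  factor `jacDetMap_actM` (`Common/TargetJacobian`); L3-p1's `det_fderiv_eq_jacDetMap` / `normSq_jacDetMap_actM`
  (`Line3/BallChangeOfVariables`) identify `jacDetMap` with `det (fderiv ℂ φ z)` and give `|jacDetMap (actM M) z|²`.
* `det_ne_zero_of_toBallMat_unitaryJ`, `toBallMat_inv`: `det γ ≠ 0` once `M(γ) ∈ U(2,1)`, and `M(γ⁻¹) = M(γ)⁻¹`.
* `isFundamentalDomainFor_image_actM_of_unitaryJ` / `isFundamentalDomainFor_image_actM` (**N1, image form**): for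
  `γ ∈ U(H)(E)` normalising `Γ′` (`∀ g, g ∈ Γ′ ↔ γ g γ⁻¹ ∈ Γ′`) and `D` a fundamental domain for `ballActions τ₀ C Γ′`,
  `Φ(D)` is again one, `Φ = actM (toBallMat τ₀ C γ)`. Proof: measurability and `Φ(D) ⊆ 𝔹` from L3-p1 / typer-2;
  a.e. covering: the bad set of `Φ(D)` lies in `Φ` of the bad set of `D` (`M_{γgγ⁻¹} ∘ Φ = Φ ∘ M_g` on the ball), which is
  null by `volume_image_actM_eq_zero`; a.e. disjointness: `M_g(Φ D) ∩ M_h(Φ D) = Φ (M_{g′} D ∩ M_{h′} D)`,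
  `g′ = γ⁻¹ g γ`; if `M_{g′} ≠ M_{h′}` the clause for `D` applies, and if `M_{g′} = M_{h′}` then `M_g = M_h` on the ball,
  so the clause for `D` applied to `(M_g, M_h)` forces `volume D = 0` and every translate of `Φ(D)` is null.
* `ball_inter_preimage_actM`, `isFundamentalDomainFor_preimage_actM` (**N1′, preimage form**): `𝔹 ∩ Φ⁻¹(D)` is a
  fundamental domain (it equals `actM (toBallMat τ₀ C γ⁻¹) '' D`; `γ⁻¹` normalises `Γ′` as well).

Nothing here asserts anything about the truth of (P); HC_CM is NOT proved by anyone in this repository.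
-/

set_option autoImplicit false

noncomputable section

namespace Summit.Ventures.HodgeRepro.Tier4.Negative

open Summit.Ventures.HodgeRepro.Tier4 Summit.Ventures.HodgeRepro.Tier4.Line3
open Matrix MeasureTheory
open scoped ComplexConjugate

variable {E : Type*} [Field E] {c : E ≃+* E} {H : Matrix (Fin 3) (Fin 3) E} {τ₀ : E →+* ℂ}
  {C : Matrix (Fin 3) (Fin 3) ℂ} {Γ' : Set (Matrix (Fin 3) (Fin 3) E)}

/-- `actM M` (`M ∈ U(2,1)`) maps a null measurable subset of the ball to a null set. -/
theorem volume_image_actM_eq_zero {M : Matrix (Fin 3) (Fin 3) ℂ} (hM : Mᴴ * J * M = J) {N : Set (Fin 2 → ℂ)}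
    (hN : MeasurableSet N) (hNb : N ⊆ ball) (h0 : volume N = 0) : volume (actM M '' N) = 0 := by
  have hdiff : ∀ z ∈ N, DifferentiableAt ℂ (actM M) z := fun z hz =>
    (differentiableOn_actM hM).differentiableAt (isOpen_ball.mem_nhds (hNb hz))
  have hf' : ∀ z ∈ N, HasFDerivWithinAt (actM M) ((fderiv ℂ (actM M) z).restrictScalars ℝ) N z :=
    fun z hz => ((hdiff z hz).hasFDerivAt.restrictScalars ℝ).hasFDerivWithinAt
  refine le_antisymm ?_ bot_le
  calc volume (actM M '' N)
      ≤ ∫⁻ z in N, ENNReal.ofReal |((fderiv ℂ (actM M) z).restrictScalars ℝ).det| ∂volume :=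
        addHaar_image_le_lintegral_abs_det_fderiv (μ := volume) hN hf'
    _ = 0 := by rw [Measure.restrict_eq_zero.mpr h0, lintegral_zero_measure]

/-- **N2 for the ball map** (corollary of typer-2's `jacDet_comp` and `jacDetMap_actM`). -/
theorem jacDet_comp_actM {M : Matrix (Fin 3) (Fin 3) ℂ} (hM : Mᴴ * J * M = J) {z : Fin 2 → ℂ} (hz : z ∈ ball)
    {u v : (Fin 2 → ℂ) → ℂ} (hu : DifferentiableAt ℂ u (actM M z)) (hv : DifferentiableAt ℂ v (actM M z)) :
    jacDet (u ∘ actM M) (v ∘ actM M) z = jacDet u v (actM M z) * (M.det / ((M *ᵥ lift3 z) 2) ^ 3) := by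
  rw [jacDet_comp hu hv ((differentiableOn_actM hM).differentiableAt (isOpen_ball.mem_nhds hz)),
    jacDetMap_actM M z (mulVec_lift3_two_ne_zero hM hz)]

/-- A matrix `γ` over `E` whose ball transfer lies in `U(2,1)` has non-zero determinant. -/
theorem det_ne_zero_of_toBallMat_unitaryJ {γ : Matrix (Fin 3) (Fin 3) E}
    (hM : (toBallMat τ₀ C γ)ᴴ * J * toBallMat τ₀ C γ = J) : γ.det ≠ 0 := by
  intro h0
  have hu := isUnit_of_unitaryJ hM
  rw [Matrix.isUnit_iff_isUnit_det, toBallMat, Matrix.det_mul, Matrix.det_mul, ← RingHom.mapMatrix_apply,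
    ← RingHom.map_det, h0, map_zero, mul_zero, zero_mul] at hu
  exact not_isUnit_zero hu

/-- The transfer of the inverse is the inverse of the transfer (for `det γ ≠ 0`, `C` invertible). -/
theorem toBallMat_inv {γ : Matrix (Fin 3) (Fin 3) E} (hC : IsUnit C) (hγ : γ.det ≠ 0) :
    toBallMat τ₀ C γ⁻¹ = (toBallMat τ₀ C γ)⁻¹ := by
  symm
  apply Matrix.inv_eq_right_inv
  rw [← toBallMat_mul τ₀ hC, Matrix.mul_nonsing_inv γ (isUnit_iff_ne_zero.mpr hγ), toBallMat_one τ₀ hC]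

/-- **N1 (image form), matrix-side hypothesis.** For `γ` over `E` whose transfer `M(γ) = toBallMat τ₀ C γ` lies in
`U(2,1)` and which normalises `Γ′` (`∀ g, g ∈ Γ′ ↔ γ g γ⁻¹ ∈ Γ′`), and `D` a fundamental domain for
`ballActions τ₀ C Γ′`, the image `actM (toBallMat τ₀ C γ) '' D` is again a fundamental domain for `ballActions τ₀ C Γ′`. -/
theorem isFundamentalDomainFor_image_actM_of_unitaryJ (hΓ : IsCongruenceSubgroup c H Γ')
    (hτ : ∀ x, τ₀ (c x) = conj (τ₀ x)) (hC : IsSylvester (H.map τ₀) C) {γ : Matrix (Fin 3) (Fin 3) E}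
    (hMγ : (toBallMat τ₀ C γ)ᴴ * J * toBallMat τ₀ C γ = J) (hnorm : ∀ g, g ∈ Γ' ↔ γ * g * γ⁻¹ ∈ Γ')
    {D : Set (Fin 2 → ℂ)} (hD : IsFundamentalDomainFor (ballActions τ₀ C Γ') D) :
    IsFundamentalDomainFor (ballActions τ₀ C Γ') (actM (toBallMat τ₀ C γ) '' D) := by
  obtain ⟨hDm, hDb, hcov, hdisj⟩ := hD
  have hdet : γ.det ≠ 0 := det_ne_zero_of_toBallMat_unitaryJ hMγ
  have hγγ : γ * γ⁻¹ = 1 := Matrix.mul_nonsing_inv γ (isUnit_iff_ne_zero.mpr hdet)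
  have hMinv : toBallMat τ₀ C γ⁻¹ = (toBallMat τ₀ C γ)⁻¹ := toBallMat_inv hC.1 hdet
  obtain ⟨Mγ, hMγdef⟩ : ∃ Mγ, toBallMat τ₀ C γ = Mγ := ⟨_, rfl⟩
  rw [hMγdef] at hMγ hMinv ⊢
  have hMγ' : Mγ⁻¹ᴴ * J * Mγ⁻¹ = J := inv_unitaryJ hMγ
  have hMγMγ : Mγ * Mγ⁻¹ = 1 :=
    Matrix.mul_nonsing_inv Mγ ((Matrix.isUnit_iff_isUnit_det Mγ).mp (isUnit_of_unitaryJ hMγ))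
  -- the normaliser relations on the matrix side
  have hconj : ∀ g, toBallMat τ₀ C (γ * g * γ⁻¹) = Mγ * toBallMat τ₀ C g * Mγ⁻¹ := fun g => by
    rw [toBallMat_mul τ₀ hC.1, toBallMat_mul τ₀ hC.1, hMinv, hMγdef]
  have hconj' : ∀ g, toBallMat τ₀ C (γ⁻¹ * g * γ) = Mγ⁻¹ * toBallMat τ₀ C g * Mγ := fun g => by
    rw [toBallMat_mul τ₀ hC.1, toBallMat_mul τ₀ hC.1, hMinv, hMγdef]
  have hmem' : ∀ g ∈ Γ', γ⁻¹ * g * γ ∈ Γ' := fun g hg => by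
    refine (hnorm _).mpr ?_
    have : γ * (γ⁻¹ * g * γ) * γ⁻¹ = g := by
      calc γ * (γ⁻¹ * g * γ) * γ⁻¹ = (γ * γ⁻¹) * g * (γ * γ⁻¹) := by simp only [Matrix.mul_assoc]
        _ = g := by rw [hγγ, Matrix.one_mul, Matrix.mul_one]
    rwa [this]
  have hunit : ∀ g ∈ Γ', (toBallMat τ₀ C g)ᴴ * J * toBallMat τ₀ C g = J := fun g hg =>
    toBallMat_unitaryJ hΓ hτ hC hg
  -- `M_g ∘ Φ = Φ ∘ M_{γ⁻¹ g γ}` on the ball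
  have key : ∀ g ∈ Γ', ∀ d ∈ ball, actM (toBallMat τ₀ C g) (actM Mγ d) =
      actM Mγ (actM (toBallMat τ₀ C (γ⁻¹ * g * γ)) d) := fun g hg d hd => by
    rw [← actM_mul hMγ hd, ← actM_mul (hunit _ (hmem' g hg)) hd, hconj']
    have e : toBallMat τ₀ C g * Mγ = Mγ * (Mγ⁻¹ * toBallMat τ₀ C g * Mγ) := by
      calc toBallMat τ₀ C g * Mγ = (Mγ * Mγ⁻¹) * toBallMat τ₀ C g * Mγ := by rw [hMγMγ, Matrix.one_mul]
        _ = Mγ * (Mγ⁻¹ * toBallMat τ₀ C g * Mγ) := by simp only [Matrix.mul_assoc]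
    rw [e]
  -- `M_{γ g γ⁻¹} ∘ Φ = Φ ∘ M_g` on the ball
  have key' : ∀ g ∈ Γ', ∀ w ∈ ball, actM (toBallMat τ₀ C (γ * g * γ⁻¹)) (actM Mγ w) =
      actM Mγ (actM (toBallMat τ₀ C g) w) := fun g hg w hw => by
    rw [hconj, actM_mul hMγ' (actM_mem_ball hMγ hw), actM_inv_actM hMγ hw, actM_mul (hunit g hg) hw]
  have hmemS : ∀ g ∈ Γ', actM (toBallMat τ₀ C g) ∈ ballActions τ₀ C Γ' := fun g hg => ⟨g, hg, rfl⟩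
  refine ⟨measurableSet_image_actM hMγ hDm hDb, Set.image_subset_iff.mpr fun z hz => actM_mem_ball hMγ (hDb hz),
    ?_, ?_⟩
  · -- a.e. covering
    rw [ae_restrict_iff' isOpen_ball.measurableSet, ae_iff] at hcov ⊢
    set N : Set (Fin 2 → ℂ) := {w | ¬(w ∈ ball → ∃ φ ∈ ballActions τ₀ C Γ', φ w ∈ D)} with hNdef
    have hN'm : MeasurableSet (toMeasurable volume N ∩ ball) :=
      (measurableSet_toMeasurable _ _).inter isOpen_ball.measurableSet
    have hN'b : toMeasurable volume N ∩ ball ⊆ ball := Set.inter_subset_right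
    have hN'0 : volume (toMeasurable volume N ∩ ball) = 0 :=
      measure_mono_null Set.inter_subset_left ((measure_toMeasurable N).trans hcov)
    refine measure_mono_null (fun z hz => ?_) (volume_image_actM_eq_zero hMγ hN'm hN'b hN'0)
    simp only [Set.mem_setOf_eq, Classical.not_imp] at hz
    obtain ⟨hzb, hz⟩ := hz
    have hw : actM Mγ⁻¹ z ∈ ball := actM_mem_ball hMγ' hzb
    refine ⟨actM Mγ⁻¹ z, ⟨subset_toMeasurable _ _ ?_, hw⟩, actM_actM_inv hMγ hzb⟩
    simp only [hNdef, Set.mem_setOf_eq, Classical.not_imp]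
    refine ⟨hw, fun ⟨φ, hφ, hφw⟩ => hz ?_⟩
    obtain ⟨g, hg, rfl⟩ := hφ
    refine ⟨actM (toBallMat τ₀ C (γ * g * γ⁻¹)), hmemS _ ((hnorm g).mp hg), ?_⟩
    have := key' g hg _ hw
    rw [actM_actM_inv hMγ hzb] at this
    rw [this]
    exact ⟨_, hφw, rfl⟩
  · -- a.e. disjointness
    intro φ hφ ψ hψ hne
    obtain ⟨g, hg, rfl⟩ := hφ
    obtain ⟨h, hh, rfl⟩ := hψ
    have himg : ∀ g ∈ Γ', actM (toBallMat τ₀ C g) '' (actM Mγ '' D) =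
        actM Mγ '' (actM (toBallMat τ₀ C (γ⁻¹ * g * γ)) '' D) := fun g hg => by
      rw [Set.image_image, Set.image_image]
      exact Set.image_congr fun d hd => key g hg d (hDb hd)
    have hsub : ∀ g ∈ Γ', actM (toBallMat τ₀ C g) '' D ⊆ ball := fun g hg =>
      Set.image_subset_iff.mpr fun d hd => actM_mem_ball (hunit g hg) (hDb hd)
    rw [himg g hg, himg h hh, ← (actM_injOn_ball hMγ).image_inter (hsub _ (hmem' g hg)) (hsub _ (hmem' h hh))]
    by_cases hne' : actM (toBallMat τ₀ C (γ⁻¹ * g * γ)) = actM (toBallMat τ₀ C (γ⁻¹ * h * γ))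
    · -- degenerate case: `φ = ψ` on the ball, so `D` itself is null
      have hφψ : actM (toBallMat τ₀ C g) '' D = actM (toBallMat τ₀ C h) '' D := by
        refine Set.image_congr fun d hd => ?_
        have h1 := key g hg (actM Mγ⁻¹ d) (actM_mem_ball hMγ' (hDb hd))
        have h2 := key h hh (actM Mγ⁻¹ d) (actM_mem_ball hMγ' (hDb hd))
        rw [actM_actM_inv hMγ (hDb hd)] at h1 h2
        rw [h1, h2, hne']
      have h0 : volume (actM (toBallMat τ₀ C g) '' D) = 0 := by
        have := hdisj _ (hmemS g hg) _ (hmemS h hh) hne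
        rwa [← hφψ, Set.inter_self] at this
      have hD0 : volume D = 0 := by
        have hDeq : actM (toBallMat τ₀ C g)⁻¹ '' (actM (toBallMat τ₀ C g) '' D) = D := by
          rw [Set.image_image]
          exact (Set.image_congr fun d hd => actM_inv_actM (hunit g hg) (hDb hd)).trans (Set.image_id' D)
        calc volume D = volume (actM (toBallMat τ₀ C g)⁻¹ '' (actM (toBallMat τ₀ C g) '' D)) := by rw [hDeq]
          _ = 0 := volume_image_actM_eq_zero (inv_unitaryJ (hunit g hg))
            (measurableSet_image_actM (hunit g hg) hDm hDb) (hsub g hg) h0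
      refine measure_mono_null (Set.image_mono Set.inter_subset_left) (volume_image_actM_eq_zero hMγ ?_ ?_ ?_)
      · exact measurableSet_image_actM (hunit _ (hmem' g hg)) hDm hDb
      · exact hsub _ (hmem' g hg)
      · exact volume_image_actM_eq_zero (hunit _ (hmem' g hg)) hDm hDb hD0
    · refine volume_image_actM_eq_zero hMγ ?_ ?_ ?_
      · exact (measurableSet_image_actM (hunit _ (hmem' g hg)) hDm hDb).inter
          (measurableSet_image_actM (hunit _ (hmem' h hh)) hDm hDb)
      · exact Set.inter_subset_left.trans (hsub _ (hmem' g hg))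
      · exact hdisj _ (hmemS _ (hmem' g hg)) _ (hmemS _ (hmem' h hh)) hne'

/-- **N1 (image form).** For `γ ∈ U(H)(E)` normalising `Γ′` (`∀ g, g ∈ Γ′ ↔ γ g γ⁻¹ ∈ Γ′`) and `D` a fundamental
domain for `ballActions τ₀ C Γ′`, the image `actM (toBallMat τ₀ C γ) '' D` is again a fundamental domain for
`ballActions τ₀ C Γ′`. -/
theorem isFundamentalDomainFor_image_actM (hΓ : IsCongruenceSubgroup c H Γ') (hτ : ∀ x, τ₀ (c x) = conj (τ₀ x))
    (hC : IsSylvester (H.map τ₀) C) {γ : Matrix (Fin 3) (Fin 3) E} (hγ : IsUnitaryOf c H γ)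
    (hnorm : ∀ g, g ∈ Γ' ↔ γ * g * γ⁻¹ ∈ Γ') {D : Set (Fin 2 → ℂ)}
    (hD : IsFundamentalDomainFor (ballActions τ₀ C Γ') D) :
    IsFundamentalDomainFor (ballActions τ₀ C Γ') (actM (toBallMat τ₀ C γ) '' D) :=
  isFundamentalDomainFor_image_actM_of_unitaryJ hΓ hτ hC (toBallMat_J τ₀ c hτ hC hγ) hnorm hD

/-- The preimage of `D ⊆ 𝔹` under `actM M` (`M ∈ U(2,1)`), cut to the ball, is the image of `D` under `actM M⁻¹`. -/
theorem ball_inter_preimage_actM {M : Matrix (Fin 3) (Fin 3) ℂ} (hM : Mᴴ * J * M = J) {D : Set (Fin 2 → ℂ)}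
    (hDb : D ⊆ ball) : ball ∩ actM M ⁻¹' D = actM M⁻¹ '' D := by
  ext z
  constructor
  · rintro ⟨hz, hzD⟩
    exact ⟨actM M z, hzD, actM_inv_actM hM hz⟩
  · rintro ⟨d, hd, rfl⟩
    refine ⟨actM_mem_ball (inv_unitaryJ hM) (hDb hd), ?_⟩
    show actM M (actM M⁻¹ d) ∈ D
    rw [actM_actM_inv hM (hDb hd)]
    exact hd

/-- **N1′ (preimage form).** Under the hypotheses of N1, `𝔹 ∩ (actM (toBallMat τ₀ C γ))⁻¹' D` is a fundamental domain
for `ballActions τ₀ C Γ′` (it equals `actM (toBallMat τ₀ C γ⁻¹) '' D`). -/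
theorem isFundamentalDomainFor_preimage_actM (hΓ : IsCongruenceSubgroup c H Γ') (hτ : ∀ x, τ₀ (c x) = conj (τ₀ x))
    (hC : IsSylvester (H.map τ₀) C) {γ : Matrix (Fin 3) (Fin 3) E} (hγ : IsUnitaryOf c H γ)
    (hnorm : ∀ g, g ∈ Γ' ↔ γ * g * γ⁻¹ ∈ Γ') {D : Set (Fin 2 → ℂ)}
    (hD : IsFundamentalDomainFor (ballActions τ₀ C Γ') D) :
    IsFundamentalDomainFor (ballActions τ₀ C Γ') (ball ∩ actM (toBallMat τ₀ C γ) ⁻¹' D) := by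
  have hMγ : (toBallMat τ₀ C γ)ᴴ * J * toBallMat τ₀ C γ = J := toBallMat_J τ₀ c hτ hC hγ
  have hdet : γ.det ≠ 0 := det_ne_zero_of_toBallMat_unitaryJ hMγ
  have hunit : IsUnit γ.det := isUnit_iff_ne_zero.mpr hdet
  have hγγ : γ * γ⁻¹ = 1 := Matrix.mul_nonsing_inv γ hunit
  have hMinv : toBallMat τ₀ C γ⁻¹ = (toBallMat τ₀ C γ)⁻¹ := toBallMat_inv hC.1 hdet
  rw [ball_inter_preimage_actM hMγ hD.2.1, ← hMinv]
  refine isFundamentalDomainFor_image_actM_of_unitaryJ hΓ hτ hC (by rw [hMinv]; exact inv_unitaryJ hMγ) ?_ hD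
  intro g
  rw [Matrix.nonsing_inv_nonsing_inv γ hunit]
  constructor
  · intro hg
    refine (hnorm _).mpr ?_
    have : γ * (γ⁻¹ * g * γ) * γ⁻¹ = g := by
      calc γ * (γ⁻¹ * g * γ) * γ⁻¹ = (γ * γ⁻¹) * g * (γ * γ⁻¹) := by simp only [Matrix.mul_assoc]
        _ = g := by rw [hγγ, Matrix.one_mul, Matrix.mul_one]
    rwa [this]
  · intro hg
    have := (hnorm _).mp hg
    have e : γ * (γ⁻¹ * g * γ) * γ⁻¹ = g := by
      calc γ * (γ⁻¹ * g * γ) * γ⁻¹ = (γ * γ⁻¹) * g * (γ * γ⁻¹) := by simp only [Matrix.mul_assoc]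
        _ = g := by rw [hγγ, Matrix.one_mul, Matrix.mul_one]
    rwa [e] at this

end Summit.Ventures.HodgeRepro.Tier4.Negative

end
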